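import Summits.Ventures.Crystal3D.Theorems.StickyWulffConstantCoaxialWallLawOnSiteDominate
import Summits.Ventures.Crystal3D.Theorems.StickyWulffConstantCoaxialWallLawOnSiteLocality
import Summits.Ventures.Crystal3D.Theorems.StickyWulffConstantCoaxialWallLawEndRowIntReadings
import HarnessLib

/-!
# THE ON-SITE BRIDGE: `EndRowOnSiteA` ⇒ the typed (A) rows at every on-site payer window; with the tails, the rows
# (crux `CoaxialWallLaw`, stmt-Ventures-19481, line `WallLedgerF`)

HONEST FRAMING. Venture `Summits/Ventures/Crystal3D` (cell `crystal3d-full`), helper `--supports` the crux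
`CoaxialWallLaw` (stmt-Ventures-19481, `route-Ventures-StickyWulffConstant`), REGISTERED line `WallLedgerF` (planner
cf-p1).  Rung credit; F-C1 not moved; census-free; CONDITIONAL on the named facts it consumes.  cf-p1 ORDER
2026-08-28T21:28:15Z item (2) — this closes the ON-SITE half of the decomposition typed in `…EndRowOnSiteDefsA`:

* `dist_eq_one_of_isEndMove`, `isEndPairSig_congr_of_agree`, `isEndPairA_transport` — plumbing;
* `endMultA_le_endMultSig_window`, `localSummandA_le_localStatSig_window` — at an on-site window, after the rigid
  motion to model position, the typed summand is dominated by the signature statistic of the pattern for any row that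
  dominates the transported systems' (A)-end pairs;
* **`localSummandA_trans_le_of_onSiteA`**, **`localSummandA_twin_le_of_onSiteA`** — for a universe of Barlow windows
  (`IsBarlowWindow`, e.g. `barlowWindowUniverse vmax`), `EndRowOnSiteA v s_F 𝒰` bounds the summand of `EndRowTransA` /
  `EndRowTwinHalfTurnA` by `s_F` at every on-site payer window, EVERY frame `L` (domination by ONE of the `20` rows:
  `dominate_trans` / `dominate_twin`);
* **`endRowTransA_of_onSiteA`**, **`endRowTwinHalfTurnA_of_onSiteA`** : `EndRowOnSiteA v s_F 𝒰 → EndRow…TailA v s_F 𝒰 →`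
  the typed (A) row; **`endRowsA_of_onSiteA_barlowWindowUniverse`** — both rows at `𝒰 = barlowWindowUniverse vmax`.
READING: lane F's by-name debts `EndRowTwinHalfTurnA v2 (9/2)`, `EndRowTransA v2 (9/2)` of
`coaxialWallLaw_of_twoRows_v2A_nineHalves` are now {`EndRowOnSiteA v2 (9/2) (barlowWindowUniverse 4)` — the certified
enumeration of PREREG-F-CERT (lit g16 / cf-p2: STEP-1/2 max `1783/420 < 9/2`), `EndRowTransTailA v2 (9/2) (…)`,
`EndRowTwinTailA v2 (9/2) (…)` — the tail theorems}.
WHAT THIS IS NOT: not the on-site fact, not the tails; F-C1 not moved.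
-/

noncomputable section

namespace Summit.Ventures.Crystal3D.Theorems

open Summit.Ventures.Crystal3D Finset
open Literature.MathematicalPhysics.StatisticalMechanics (barlowStacking IsHaggSeq basalMirror)
open scoped InnerProductSpace

/-! ### Plumbing -/

/-- In an end move with a unit direction, `q` is a contact of `b`. -/
theorem dist_eq_one_of_isEndMove {X : Finset (EuclideanSpace ℝ (Fin 3))} {v : WordVersion}
    {G : EuclideanSpace ℝ (Fin 3) ≃ₗᵢ[ℝ] EuclideanSpace ℝ (Fin 3)} {d q b : EuclideanSpace ℝ (Fin 3)} (hd : ‖d‖ = 1)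
    (h : IsEndMove X v G d q b) : dist b q = 1 := by
  rcases h with ⟨-, hb, -⟩ | ⟨m, ⟨⟨hm1, -⟩, -⟩, -, hb, -⟩
  · rw [hb, dist_comm, dist_eq_norm, show q - (q + d) = -d by abel, norm_neg, hd]
  · rw [dist_eq_norm, norm_sub_eq_one_of_cross hd hm1 hb]

open scoped Classical in
/-- Signature pairs near the origin depend only on the closed radius-`3` window (slot signatures). -/
theorem isEndPairSig_congr_of_agree {X Y : Finset (EuclideanSpace ℝ (Fin 3))}
    (h : ∀ x, dist (0 : EuclideanSpace ℝ (Fin 3)) x ≤ 3 → (x ∈ X ↔ x ∈ Y)) {v : WordVersion}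
    {sig : Finset (Bool × EuclideanSpace ℝ (Fin 3))} (hsig : ∀ σ ∈ sig, σ.2 ∈ fccSlots)
    {b q : EuclideanSpace ℝ (Fin 3)} (hb : dist (0 : EuclideanSpace ℝ (Fin 3)) b ≤ 1) (hp : IsEndPairSig X v sig b q) :
    IsEndPairSig Y v sig b q := by
  obtain ⟨hq, hbX, hpay, σ, hσ, hqd, hmove⟩ := hp
  have hd1 : ‖sigDir σ‖ = 1 := norm_sigDir (ε := σ.1) (hsig σ hσ)
  have hbq : dist b q = 1 := dist_eq_one_of_isEndMove hd1 hmove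
  have hq2 : dist (0 : EuclideanSpace ℝ (Fin 3)) q ≤ 2 := by linarith [dist_triangle (0 : EuclideanSpace ℝ (Fin 3)) b q]
  have hqd3 : dist (0 : EuclideanSpace ℝ (Fin 3)) (q - sigDir σ) ≤ 3 := by
    have : dist q (q - sigDir σ) = 1 := by rw [dist_eq_norm, sub_sub_cancel, hd1]
    linarith [dist_triangle (0 : EuclideanSpace ℝ (Fin 3)) q (q - sigDir σ)]
  exact ⟨(h q (by linarith)).1 hq, (h b (by linarith)).1 hbX, (hasTwoPayers_congr_of_agree h (by linarith)).1 hpay, σ, hσ,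
    (h _ hqd3).1 hqd, (isEndMove_congr_of_agree h v (sigFrame σ.1) hd1 (by linarith) (by linarith)).1 hmove⟩

open scoped Classical in
/-- **(A)-end pairs transport** under a rigid motion, with the plate systems' base frames transported. -/
theorem isEndPairA_transport {X : Finset (EuclideanSpace ℝ (Fin 3))} {v : WordVersion}
    (S : EuclideanSpace ℝ (Fin 3) ≃ₗᵢ[ℝ] EuclideanSpace ℝ (Fin 3)) (c : EuclideanSpace ℝ (Fin 3))
    (L₁ L₂ : EuclideanSpace ℝ (Fin 3) ≃ₗᵢ[ℝ] EuclideanSpace ℝ (Fin 3)) (R₁ R₂ : Finset (EuclideanSpace ℝ (Fin 3)))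
    {b q : EuclideanSpace ℝ (Fin 3)} (h : IsEndPairA X v ⟨L₁, R₁⟩ ⟨L₂, R₂⟩ b q) :
    IsEndPairA (X.image fun x => S x + c) v ⟨L₁.trans S, R₁⟩ ⟨L₂.trans S, R₂⟩ (S b + c) (S q + c) := by
  obtain ⟨hq, hb, hpay, G, d, hadm, hqd, hmove⟩ := h
  refine ⟨mem_image_of_mem _ hq, mem_image_of_mem _ hb, hasTwoPayers_transport X S c hpay, G.trans S, S d, ?_, ?_,
    isEndMove_transport S c hmove⟩
  · rcases hadm with hadm | hadm
    · exact Or.inl (PlateSystem.adm_transport S L₁ R₁ hadm)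
    · exact Or.inr (PlateSystem.adm_transport S L₂ R₂ hadm)
  · have : S q + c - S d = S (q - d) + c := by rw [map_sub]; abel
    rw [this]; exact mem_image_of_mem _ hqd

/-! ### The window comparison -/

section Window

variable {v : WordVersion} {X P : Finset (EuclideanSpace ℝ (Fin 3))} {z : EuclideanSpace ℝ (Fin 3)}
  (S : EuclideanSpace ℝ (Fin 3) ≃ₗᵢ[ℝ] EuclideanSpace ℝ (Fin 3))
  (hagree : ∀ y, dist (0 : EuclideanSpace ℝ (Fin 3)) y ≤ 3 → (y ∈ X.image (fun x => S.symm x + -S.symm z) ↔ y ∈ P))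

/-- The model-position motion takes the payer to the origin and preserves distances to it. -/
theorem dist_zero_motion (b : EuclideanSpace ℝ (Fin 3)) : dist (0 : EuclideanSpace ℝ (Fin 3)) (S.symm b + -S.symm z) = dist z b := by
  have : S.symm z + -S.symm z = 0 := add_neg_cancel _
  rw [← this, dist_rigid]

include hagree

open scoped Classical in
/-- **Multiplicity comparison**: if the row `sig` dominates the transported systems' (A)-end pairs near the origin, then
`endMultA X b ≤ endMultSig P (T b)` at every ball within `1` of the payer. -/
theorem endMultA_le_endMultSig_window (L₁ L₂ : EuclideanSpace ℝ (Fin 3) ≃ₗᵢ[ℝ] EuclideanSpace ℝ (Fin 3))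
    (R₁ R₂ : Finset (EuclideanSpace ℝ (Fin 3))) {sig : Finset (Bool × EuclideanSpace ℝ (Fin 3))}
    (hsig : ∀ σ ∈ sig, σ.2 ∈ fccSlots)
    (hdom : ∀ b q : EuclideanSpace ℝ (Fin 3), dist (0 : EuclideanSpace ℝ (Fin 3)) b ≤ 1 →
      IsEndPairA (X.image fun x => S.symm x + -S.symm z) v ⟨L₁.trans S.symm, R₁⟩ ⟨L₂.trans S.symm, R₂⟩ b q →
      IsEndPairSig (X.image fun x => S.symm x + -S.symm z) v sig b q)
    {b : EuclideanSpace ℝ (Fin 3)} (hb : dist z b ≤ 1) :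
    endMultA X v ⟨L₁, R₁⟩ ⟨L₂, R₂⟩ b ≤ endMultSig P v sig (S.symm b + -S.symm z) := by
  unfold endMultA endMultSig
  refine card_le_card_of_injOn (fun x => S.symm x + -S.symm z) (fun q hq => ?_) fun x _ y _ hxy => rigid_injective S.symm _ hxy
  rw [mem_coe, mem_filter] at hq ⊢
  have hb0 : dist (0 : EuclideanSpace ℝ (Fin 3)) (S.symm b + -S.symm z) ≤ 1 := by rw [dist_zero_motion]; exact hb
  have h1 := isEndPairA_transport S.symm (-S.symm z) L₁ L₂ R₁ R₂ hq.2
  have h2 := hdom _ _ hb0 h1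
  have h3 := isEndPairSig_congr_of_agree hagree hsig hb0 h2
  exact ⟨h3.1, h3⟩

open scoped Classical in
/-- **Pooled deficiency comparison**: `pooledDef X b = pooledDef P (T b)` at every ball within `1` of the payer. -/
theorem pooledDef_eq_window {b : EuclideanSpace ℝ (Fin 3)} (hb : dist z b ≤ 1) :
    pooledDef X b = pooledDef P (S.symm b + -S.symm z) := by
  rw [← pooledDef_transport X S.symm (-S.symm z) b]
  exact pooledDef_congr_of_agree hagree (by rw [dist_zero_motion]; linarith)

open scoped Classical in
/-- **Summand comparison**: the typed summand at the payer `z` is at most the signature statistic of the pattern at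
the origin, for any dominating row. -/
theorem localSummandA_le_localStatSig_window (L₁ L₂ : EuclideanSpace ℝ (Fin 3) ≃ₗᵢ[ℝ] EuclideanSpace ℝ (Fin 3))
    (R₁ R₂ : Finset (EuclideanSpace ℝ (Fin 3))) {sig : Finset (Bool × EuclideanSpace ℝ (Fin 3))}
    (hsig : ∀ σ ∈ sig, σ.2 ∈ fccSlots)
    (hdom : ∀ b q : EuclideanSpace ℝ (Fin 3), dist (0 : EuclideanSpace ℝ (Fin 3)) b ≤ 1 →
      IsEndPairA (X.image fun x => S.symm x + -S.symm z) v ⟨L₁.trans S.symm, R₁⟩ ⟨L₂.trans S.symm, R₂⟩ b q →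
      IsEndPairSig (X.image fun x => S.symm x + -S.symm z) v sig b q) :
    localSummandA v ⟨L₁, R₁⟩ ⟨L₂, R₂⟩ X z ≤ localStatSig P v sig 0 := by
  unfold localSummandA localStatSig
  set T : EuclideanSpace ℝ (Fin 3) → EuclideanSpace ℝ (Fin 3) := fun x => S.symm x + -S.symm z with hT
  set A := X.filter (fun b => dist z b ≤ 1 ∧ 0 < endMultA X v ⟨L₁, R₁⟩ ⟨L₂, R₂⟩ b) with hA
  set g : EuclideanSpace ℝ (Fin 3) → ℝ := fun b' => (endMultSig P v sig b' : ℝ) / pooledDef P b' with hg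
  have hg0 : ∀ b', 0 ≤ g b' := fun b' => div_nonneg (Nat.cast_nonneg _) (EndRowFloor.pooledDef_nonneg P b')
  -- termwise comparison
  have step1 : ∑ b ∈ A, (endMultA X v ⟨L₁, R₁⟩ ⟨L₂, R₂⟩ b : ℝ) / pooledDef X b ≤ ∑ b ∈ A, g (T b) := by
    refine sum_le_sum fun b hb => ?_
    obtain ⟨hbX, hd, -⟩ := mem_filter.1 hb
    rw [hg]; dsimp only
    rw [pooledDef_eq_window S hagree hd]
    exact div_le_div_of_nonneg_right (by exact_mod_cast endMultA_le_endMultSig_window S hagree L₁ L₂ R₁ R₂ hsig hdom hd)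
      (EndRowFloor.pooledDef_nonneg P _)
  -- reindex by the motion
  have step2 : ∑ b ∈ A, g (T b) = ∑ b' ∈ A.image T, g b' :=
    (sum_image fun x _ y _ hxy => rigid_injective S.symm _ hxy).symm
  -- the image lies inside the pattern's index set
  have step3 : A.image T ⊆ P.filter (fun b' => dist (0 : EuclideanSpace ℝ (Fin 3)) b' ≤ 1 ∧ 0 < endMultSig P v sig b') := by
    intro b' hb'
    obtain ⟨b, hb, rfl⟩ := mem_image.1 hb'
    obtain ⟨hbX, hd, hpos⟩ := mem_filter.1 hb
    have hle := endMultA_le_endMultSig_window S hagree L₁ L₂ R₁ R₂ hsig hdom hd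
    have hd0 : dist (0 : EuclideanSpace ℝ (Fin 3)) (T b) ≤ 1 := by rw [hT]; dsimp only; rw [dist_zero_motion]; exact hd
    refine mem_filter.2 ⟨(hagree _ (by linarith)).1 (mem_image_of_mem _ hbX), hd0, lt_of_lt_of_le hpos hle⟩
  calc ∑ b ∈ A, (endMultA X v ⟨L₁, R₁⟩ ⟨L₂, R₂⟩ b : ℝ) / pooledDef X b
      ≤ ∑ b' ∈ A.image T, g b' := by rw [← step2]; exact step1
    _ ≤ ∑ b' ∈ P.filter (fun b' => dist (0 : EuclideanSpace ℝ (Fin 3)) b' ≤ 1 ∧ 0 < endMultSig P v sig b'), g b' :=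
        sum_le_sum_of_subset_of_nonneg step3 fun b' _ _ => hg0 b'

end Window

/-! ### The bridge -/

/-- Signatures of the translation rows are slot signatures. -/
theorem transSigs_slots (ε : Bool) (n : EuclideanSpace ℝ (Fin 3)) : ∀ σ ∈ transSigs ε n, σ.2 ∈ fccSlots := by
  classical
  intro σ hσ
  rcases mem_union.1 hσ with h | h
  · obtain ⟨w, hw, rfl⟩ := mem_image.1 h
    exact (mem_filter.1 hw).1
  · obtain ⟨w, hw, rfl⟩ := mem_image.1 h
    exact (mem_filter.1 (mem_filter.1 hw).1).1

/-- Signatures of the twin rows are slot signatures. -/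
theorem twinSigs_slots (ε : Bool) (h : EuclideanSpace ℝ (Fin 3)) : ∀ σ ∈ twinSigs ε h, σ.2 ∈ fccSlots := by
  classical
  intro σ hσ
  rcases mem_union.1 hσ with h' | h'
  · obtain ⟨w, hw, rfl⟩ := mem_image.1 h'
    exact (mem_filter.1 (mem_filter.1 hw).1).1
  · obtain ⟨w, hw, rfl⟩ := mem_image.1 h'
    exact neg_mem_fccSlots (mem_filter.1 (mem_filter.1 hw).1).1

section Bridge

variable {v : WordVersion} {sF : ℝ} {𝒰 : Set (Finset (EuclideanSpace ℝ (Fin 3)))}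
  (h𝒰 : ∀ P ∈ 𝒰, IsBarlowWindow P) (hon : EndRowOnSiteA v sF 𝒰)
include h𝒰 hon

open scoped Classical in
/-- **THE BRIDGE, translation row**: at an on-site payer window the typed summand is `≤ s_F`, for every frame. -/
theorem localSummandA_trans_le_of_onSiteA (L : EuclideanSpace ℝ (Fin 3) ≃ₗᵢ[ℝ] EuclideanSpace ℝ (Fin 3))
    {X : Finset (EuclideanSpace ℝ (Fin 3))} {z : EuclideanSpace ℝ (Fin 3)} (hsite : OnSiteAt 𝒰 X z) :
    localSummandA v ⟨L, inPlaneRoots L 1⟩ ⟨L, inPlaneRoots L (-1)⟩ X z ≤ sF := by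
  obtain ⟨P, hP, S, hwin⟩ := hsite
  obtain ⟨s, hs, hPs⟩ := h𝒰 P hP
  have hagree := onSite_window_agree hwin
  have hY : ∀ x ∈ X.image (fun x => S.symm x + -S.symm z), dist (0 : EuclideanSpace ℝ (Fin 3)) x ≤ 3 →
      x ∈ barlowStacking 1 (Real.sqrt (2 / 3)) s :=
    fun x hx hd => hPs (mem_coe.2 ((hagree x hd).1 hx))
  obtain ⟨ε, n, hn, hdom⟩ := dominate_trans (v := v) hs hY (L.trans S.symm) (inPlaneRoots L 1) (inPlaneRoots L (-1))
    (inPlaneRoots_subset_basalHexagon L 1) (inPlaneRoots_subset_basalHexagon L (-1))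
  exact (localSummandA_le_localStatSig_window S hagree L L _ _ (transSigs_slots ε n) hdom).trans ((hon P hP).1 ε n hn)

open scoped Classical in
/-- **THE BRIDGE, twin row (half-turn form)**: at an on-site payer window the typed summand is `≤ s_F`, every frame. -/
theorem localSummandA_twin_le_of_onSiteA (L : EuclideanSpace ℝ (Fin 3) ≃ₗᵢ[ℝ] EuclideanSpace ℝ (Fin 3))
    {X : Finset (EuclideanSpace ℝ (Fin 3))} {z : EuclideanSpace ℝ (Fin 3)} (hsite : OnSiteAt 𝒰 X z) :
    localSummandA v ⟨L, inPlaneRoots L 1⟩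
      ⟨((ℝ ∙ EuclideanSpace.single (2 : Fin 3) (1 : ℝ)).reflection).trans L,
        inPlaneRoots (((ℝ ∙ EuclideanSpace.single (2 : Fin 3) (1 : ℝ)).reflection).trans L) (-1)⟩ X z ≤ sF := by
  obtain ⟨P, hP, S, hwin⟩ := hsite
  obtain ⟨s, hs, hPs⟩ := h𝒰 P hP
  have hagree := onSite_window_agree hwin
  have hY : ∀ x ∈ X.image (fun x => S.symm x + -S.symm z), dist (0 : EuclideanSpace ℝ (Fin 3)) x ≤ 3 →
      x ∈ barlowStacking 1 (Real.sqrt (2 / 3)) s :=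
    fun x hx hd => hPs (mem_coe.2 ((hagree x hd).1 hx))
  rw [inPlaneRoots_halfTurn]
  -- the roots lie in the open half-plane of `u = L⁻¹ e₃`
  have hRu : ∀ r ∈ inPlaneRoots L 1, 0 < ⟪r, L.symm (EuclideanSpace.single (2 : Fin 3) (1 : ℝ))⟫_ℝ := by
    intro r hr
    obtain ⟨-, -, hpos⟩ := mem_filter.1 hr
    rw [one_mul] at hpos
    rwa [← LinearIsometryEquiv.inner_map_map L, LinearIsometryEquiv.apply_symm_apply, inner_single_two_one]
  have hassoc : (((ℝ ∙ EuclideanSpace.single (2 : Fin 3) (1 : ℝ)).reflection).trans L).trans S.symm =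
      ((ℝ ∙ EuclideanSpace.single (2 : Fin 3) (1 : ℝ)).reflection).trans (L.trans S.symm) :=
    LinearIsometryEquiv.ext fun _ => rfl
  rcases dominate_twin (v := v) hs hY (L.trans S.symm) (inPlaneRoots L 1) (inPlaneRoots_subset_basalHexagon L 1)
      (L.symm (EuclideanSpace.single (2 : Fin 3) (1 : ℝ))) hRu with ⟨ε, n, hn, hdom⟩ | ⟨ε, h, hh, hdom⟩
  · rw [← hassoc] at hdom
    exact (localSummandA_le_localStatSig_window S hagree L _ _ _ (transSigs_slots ε n) hdom).trans ((hon P hP).1 ε n hn)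
  · rw [← hassoc] at hdom
    exact (localSummandA_le_localStatSig_window S hagree L _ _ _ (twinSigs_slots ε h) hdom).trans ((hon P hP).2 ε h hh)

/-- **`EndRowTransA` from the on-site fact and the translation tail.** -/
theorem endRowTransA_of_onSiteA (htail : EndRowTransTailA v sF 𝒰) : EndRowTransA v sF :=
  endRowTransA_of_onSite_of_tail 𝒰 (fun L _ _ _ _ _ hsite => localSummandA_trans_le_of_onSiteA h𝒰 hon L hsite) htail

/-- **`EndRowTwinHalfTurnA` from the on-site fact and the twin tail.** -/
theorem endRowTwinHalfTurnA_of_onSiteA (htail : EndRowTwinTailA v sF 𝒰) : EndRowTwinHalfTurnA v sF :=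
  endRowTwinHalfTurnA_of_onSite_of_tail 𝒰 (fun L _ _ _ _ _ hsite => localSummandA_twin_le_of_onSiteA h𝒰 hon L hsite)
    htail

end Bridge

/-- **Both typed (A) rows from the U-W on-site fact and the two tails** (any version, constant, `vmax`): the form lane
F's capstone `coaxialWallLaw_of_twoRows_v2A_nineHalves` consumes at `v = v2`, `s_F = 9/2`, `vmax = 4`. -/
theorem endRowsA_of_onSiteA_barlowWindowUniverse {v : WordVersion} {sF : ℝ} {vmax : ℕ}
    (hon : EndRowOnSiteA v sF (barlowWindowUniverse vmax)) (htailT : EndRowTransTailA v sF (barlowWindowUniverse vmax))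
    (htailW : EndRowTwinTailA v sF (barlowWindowUniverse vmax)) :
    EndRowTwinHalfTurnA v sF ∧ EndRowTransA v sF :=
  ⟨endRowTwinHalfTurnA_of_onSiteA (fun _ hP => isBarlowWindow_of_mem_barlowWindowUniverse hP) hon htailW,
    endRowTransA_of_onSiteA (fun _ hP => isBarlowWindow_of_mem_barlowWindowUniverse hP) hon htailT⟩

end Summit.Ventures.Crystal3D.Theorems

end
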